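import Summits.AtomisticToContinuum.HydrodynamicLimit.Theorems.AntiMazurCoboundariesKineticFluxLdDecayHTheoremObjects
import Literature.Analysis.UnboundedOperators.LinearizedBoltzmannQuarticWeakForm
import Literature.Analysis.UnboundedOperators.LinearizedBoltzmannPolynomialInverse
import Literature.Probability.Divergences.HellingerKullback
import HarnessLib

/-!
# Stub `stub_gainDomination` of the crux line `h-theorem-dissipation-budget`
# (crux `KineticFluxLdDecay`, stmt-AtomisticToContinuum-10967)

The KINETIC LEMMA of the line (gain–dissipation duality, nonlinear; `GainDomination` of the objects module
`…KineticFluxLdDecayHTheoremObjects`): there is an absolute amplitude `κ₁ > 0` such that for every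
continuous `|g| ≤ κ₁` with `g ⊥ span{1, v, |v|²}` in `L²(γ)` there is `C ≥ 0` with, for every measurable
`|φ| ≤ 1` and every one-body probability law `f ≪ vol ⊗ γ` of finite velocity entropy and Hellinger
production `≤ d`, `∫ φ(x) g(w) df ≤ C √d + ½ KL(f ‖ f₁ ⊗ γ)`.

Proof (weak formulation; no local-equilibrium case analysis, no bounded corrector).
* `ψ := L⁻¹ g` continuous with `|ψ| ≤ C_K κ₁ (1+|v|²)²`
  (`exists_continuous_inverse_hardSphereLinearizedOp_quartic`).
* FIBRE BOUND (`enorm_integral_mul_le_sqrt_production_add`): for one velocity density `r ≥ 0`, `r ∈ L¹(γ)`,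
  `s = √r`, `ζ = s - c` (any constant `c`), `Ξ = s's_*' - s s_*` (`hellingerDefect r`), the identity
  `∫ g r dγ = ∫ g ζ² dγ - ½ ∫ B M M_* (Tψ) Ξ dλ - ∫ B M M_* (Tψ) ζ(v) ζ(v_*) dλ` (weak formulation
  `∫ B M M_* (Tψ) h(v) dλ = ∫ h Lψ dγ`, exchange and pre/post involutions, all from
  `LinearizedBoltzmannQuarticWeakForm`) and Cauchy–Schwarz twice give, in `ℝ≥0∞`,
  `‖∫ g r dγ‖ ≤ ½ ‖Tψ‖_B ‖Ξ‖_B + (K A + b) ∫ (√r - c)² dγ`.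
* ASSEMBLY (`stub_gainDomination`): disintegrate `∫ φ g df = ∫ φ(x) (∫ g ρ(x,·) dγ) dx` (`ρ = df/d(vol⊗γ)`),
  apply the fibre bound with `c = √n(x)`, `n = df₁/dvol`, integrate in `x` (`vol 𝕋³ = 1`, Cauchy–Schwarz
  `∫ 𝒟_x^{1/2} ≤ (∫ 𝒟_x)^{1/2} ≤ √d`), and bound `∫∫ (√ρ - √n)² dγ dx ≤ KL(f ‖ f₁ ⊗ γ)`
  (`Literature.Probability.Divergences.lintegral_sqrt_rnDeriv_sub_sqrt_fst_sq_le_klDiv`);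
  `κ₁ := 1/(2(K C_K + 1))` makes the Hellinger coefficient `½`, and `C := ½ ‖Tψ‖_B`.
-/

noncomputable section

open MeasureTheory ProbabilityTheory Set Filter InformationTheory
open scoped ENNReal

namespace Summit.AtomisticToContinuum.HydrodynamicLimit.Theorems.HTheorem

open Literature.MathematicalPhysics.KineticTheory (T3 V3 collide sphereMeasure)
open Literature.Analysis.FluidPDE
open Literature.Analysis.UnboundedOperators

/-! ## Weighted Cauchy–Schwarz -/

/-- **Weighted Cauchy–Schwarz** for a nonnegative weight `ρ`:
`∫ ‖ρ u w‖ ≤ (∫ ρ u²)^{1/2} (∫ ρ w²)^{1/2}` as `ℝ≥0∞`-integrals. -/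
theorem lintegral_enorm_weight_mul_mul_le {X : Type*} [MeasurableSpace X] {μ : Measure X}
    {ρ u w : X → ℝ} (hρ : ∀ x, 0 ≤ ρ x) (hρm : Measurable ρ) (hum : Measurable u) (hwm : Measurable w) :
    ∫⁻ x, ‖ρ x * (u x * w x)‖ₑ ∂μ ≤
      (∫⁻ x, ENNReal.ofReal (ρ x * u x ^ 2) ∂μ) ^ (1 / 2 : ℝ) *
        (∫⁻ x, ENNReal.ofReal (ρ x * w x ^ 2) ∂μ) ^ (1 / 2 : ℝ) := by
  set F : X → ℝ≥0∞ := fun x => ‖Real.sqrt (ρ x) * u x‖ₑ with hF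
  set G : X → ℝ≥0∞ := fun x => ‖Real.sqrt (ρ x) * w x‖ₑ with hG
  have hFm : AEMeasurable F μ := (hρm.sqrt.mul hum).enorm.aemeasurable
  have hGm : AEMeasurable G μ := (hρm.sqrt.mul hwm).enorm.aemeasurable
  have hsq : ∀ (a : X → ℝ) (x : X), ‖Real.sqrt (ρ x) * a x‖ₑ ^ (2 : ℝ) = ENNReal.ofReal (ρ x * a x ^ 2) := by
    intro a x
    rw [Real.enorm_eq_ofReal_abs, ENNReal.ofReal_rpow_of_nonneg (abs_nonneg _) two_pos.le, Real.rpow_two,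
      sq_abs, mul_pow, Real.sq_sqrt (hρ x)]
  have hpt : ∀ x, ‖ρ x * (u x * w x)‖ₑ = F x * G x := fun x => by
    simp only [hF, hG, ← enorm_mul]
    congr 1
    calc ρ x * (u x * w x) = (Real.sqrt (ρ x) * Real.sqrt (ρ x)) * (u x * w x) := by
          rw [Real.mul_self_sqrt (hρ x)]
      _ = _ := by ring
  have hCS := ENNReal.lintegral_mul_le_Lp_mul_Lq μ Real.HolderConjugate.two_two hFm hGm
  simp only [Pi.mul_apply, hF, hG, hsq] at hCS
  calc ∫⁻ x, ‖ρ x * (u x * w x)‖ₑ ∂μ = ∫⁻ x, F x * G x ∂μ := lintegral_congr hpt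
    _ ≤ _ := hCS

/-! ## The fibre bound -/

/-- **Gain–dissipation duality on one fibre** (the kinetic lemma of the line, per position `x`). Let
`g = L ψ` pointwise with `ψ` measurable, `|ψ(v)| ≤ A (1+|v|²)²`, `|g| ≤ b`, `∫ g dγ = 0`, and let `K`
be a Gaussian-moment constant of `LinearizedBoltzmannQuarticWeakForm` for `ψ`
(`∫ B M M_* |Tψ| |F| dλ ≤ K A ‖F‖_{L²(γ⊗γ)}`). Then for every measurable velocity density `r ≥ 0`,
`r ∈ L¹(γ)`, and every constant `c`,
`‖∫ g r dγ‖ ≤ ½ (∫ B M M_* (Tψ)²)^{1/2} (∫ B M M_* Ξ(r)²)^{1/2} + (K A + b) ∫ (√r - c)² dγ`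
with `Ξ(r) = hellingerDefect r` — in `ℝ≥0∞`, so that an infinite fibre production is allowed.
Proof: `r = (c + ζ)²`, `∫ g r = ∫ g ζ² + 2c ∫ g √r`; `2c ∫ g √r = ∫ B M M_*(Tψ)(√r√r_* - ζζ_*)`
(weak formulation for `h = √r, 1`, exchange symmetry, `∫ g dγ = 0`);
`∫ B M M_* (Tψ) √r√r_* = -½ ∫ B M M_* (Tψ) Ξ` (pre/post antisymmetry); Cauchy–Schwarz twice. -/
theorem enorm_integral_mul_le_sqrt_production_add {g ψ : V3 → ℝ} {A b K : ℝ} (hgm : Measurable g)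
    (hgb : ∀ w, |g w| ≤ b) (hg0 : ∫ w, g w ∂stdGaussian V3 = 0) (hψm : Measurable ψ)
    (hψ : ∀ u, |ψ u| ≤ A * (1 + ‖u‖ ^ 2) ^ 2) (hL : ∀ v, hardSphereLinearizedOp ψ v = g v) (hK0 : 0 ≤ K)
    (hK : ∀ F : V3 × V3 → ℝ, AEStronglyMeasurable F ((stdGaussian V3).prod (stdGaussian V3)) →
      ∫⁻ q, ‖collisionDensity q * ((ψ (collide q.2 q.1).1 + ψ (collide q.2 q.1).2 - ψ q.1.1 - ψ q.1.2) *
          F q.1)‖ₑ ∂collMeasure ≤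
        ENNReal.ofReal K * ENNReal.ofReal A * eLpNorm F 2 ((stdGaussian V3).prod (stdGaussian V3)))
    {r : V3 → ℝ} (hrm : Measurable r) (hr0 : ∀ w, 0 ≤ r w) (hri : Integrable r (stdGaussian V3)) (c : ℝ) :
    ‖∫ w, g w * r w ∂stdGaussian V3‖ₑ ≤
      2⁻¹ * (∫⁻ q, ENNReal.ofReal (collisionDensity q *
          (ψ (collide q.2 q.1).1 + ψ (collide q.2 q.1).2 - ψ q.1.1 - ψ q.1.2) ^ 2) ∂collMeasure) ^ (1 / 2 : ℝ) *
        (∫⁻ q, ENNReal.ofReal (collisionDensity q * hellingerDefect r q ^ 2) ∂collMeasure) ^ (1 / 2 : ℝ) +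
      ENNReal.ofReal (K * A + b) * ∫⁻ w, ENNReal.ofReal ((Real.sqrt (r w) - c) ^ 2) ∂stdGaussian V3 := by
  haveI := isFiniteMeasure_sphereMeasure (E := V3)
  simp only [collMeasure] at hK ⊢
  obtain ⟨hA, -⟩ := abs_le_one_add_norm_pow_four_of_quartic hψ
  have hb : 0 ≤ b := (abs_nonneg _).trans (hgb 0)
  -- notation
  set γ : Measure V3 := stdGaussian V3 with hγ
  set Λ : Measure CollSpace := ((volume : Measure V3).prod volume).prod sphereMeasure with hΛ
  set T : CollSpace → ℝ := fun q =>
    ψ (collide q.2 q.1).1 + ψ (collide q.2 q.1).2 - ψ q.1.1 - ψ q.1.2 with hT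
  set s : V3 → ℝ := fun w => Real.sqrt (r w) with hs
  set ζ : V3 → ℝ := fun w => s w - c with hζ
  have hs2 : ∀ w, s w ^ 2 = r w := fun w => Real.sq_sqrt (hr0 w)
  have hsm : Measurable s := hrm.sqrt
  have hs_mem : MemLp s 2 γ :=
    (memLp_two_iff_integrable_sq hsm.aestronglyMeasurable).2 (by simp_rw [hs2]; exact hri)
  have hζ_mem : MemLp ζ 2 γ := hs_mem.sub (memLp_const c)
  have h1_mem : MemLp (fun _ : V3 => (1 : ℝ)) 2 γ := memLp_const 1
  -- integrability on `γ`
  have hbdd : ∀ {u : V3 → ℝ}, Integrable u γ → Integrable (fun w => g w * u w) γ := fun hu =>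
    hu.bdd_mul hgm.aestronglyMeasurable (ae_of_all _ fun w => by rw [Real.norm_eq_abs]; exact hgb w)
  have hgi : Integrable g γ := by simpa using hbdd (integrable_const (1 : ℝ))
  have hgs : Integrable (fun w => g w * s w) γ := hbdd (hs_mem.integrable one_le_two)
  have hgζ2 : Integrable (fun w => g w * ζ w ^ 2) γ := hbdd hζ_mem.integrable_sq
  -- the `γ`-identity `∫ g r = ∫ g ζ² + 2c ∫ g s`
  have hγid : ∫ w, g w * r w ∂γ = ∫ w, g w * ζ w ^ 2 ∂γ + 2 * c * ∫ w, g w * s w ∂γ := by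
    have hpt : (fun w => g w * r w) = fun w => g w * ζ w ^ 2 + 2 * c * (g w * s w) - c ^ 2 * g w := by
      funext w; simp only [hζ]; rw [← hs2 w]; ring
    rw [hpt, integral_sub (f := fun w => g w * ζ w ^ 2 + 2 * c * (g w * s w)) (hgζ2.add (hgs.const_mul _))
      (hgi.const_mul _), integral_add hgζ2 (hgs.const_mul _), integral_const_mul, integral_const_mul, hg0]
    ring
  -- integrability on `Λ`
  have hI : ∀ {h₁ h₂ : V3 → ℝ}, MemLp h₁ 2 γ → MemLp h₂ 2 γ →
      Integrable (fun q : CollSpace => collisionDensity q * (T q * (h₁ q.1.1 * h₂ q.1.2))) Λ :=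
    fun hh₁ hh₂ => integrable_collisionDensity_transfer_mul_mul hψm hψ hh₁ hh₂
  have i_ss := hI hs_mem hs_mem
  have i_ζζ := hI hζ_mem hζ_mem
  have i_s : Integrable (fun q : CollSpace => collisionDensity q * (T q * s q.1.1)) Λ :=
    (hI hs_mem h1_mem).congr (ae_of_all _ fun q => by simp only [mul_one])
  have i_s' : Integrable (fun q : CollSpace => collisionDensity q * (T q * s q.1.2)) Λ :=
    (hI h1_mem hs_mem).congr (ae_of_all _ fun q => by simp only [one_mul])
  have i_1 : Integrable (fun q : CollSpace => collisionDensity q * T q) Λ :=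
    (hI h1_mem h1_mem).congr (ae_of_all _ fun q => by simp only [mul_one])
  have i_pp : Integrable (fun q : CollSpace => collisionDensity q *
      (T q * (s (collide q.2 q.1).1 * s (collide q.2 q.1).2))) Λ := by
    have h := (measurePreserving_collide_negDir (E := V3)).integrable_comp_of_integrable i_ss.neg
    refine h.congr (ae_of_all _ fun q => ?_)
    simp only [Function.comp_apply, Pi.neg_apply, hT, collisionDensity_collide_negDir, transfer_collide_negDir]
    ring
  -- the `Λ`-identities
  have e_pp : ∫ q, collisionDensity q * (T q * (s (collide q.2 q.1).1 * s (collide q.2 q.1).2)) ∂Λ =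
      -∫ q, collisionDensity q * (T q * (s q.1.1 * s q.1.2)) ∂Λ := by
    have h := integral_collisionDensity_transfer_mul_collide_eq_neg ψ (fun p : V3 × V3 => s p.1 * s p.2)
    simpa only [hT] using h
  have e_s' : ∫ q, collisionDensity q * (T q * s q.1.2) ∂Λ = ∫ q, collisionDensity q * (T q * s q.1.1) ∂Λ :=
    integral_collisionDensity_transfer_mul_snd_eq ψ s
  have e_s : ∫ q, collisionDensity q * (T q * s q.1.1) ∂Λ = ∫ w, g w * s w ∂γ := by
    rw [hT, integral_collisionDensity_transfer_mul_eq_integral_mul_hardSphereLinearizedOp hψm hψ hs_mem]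
    refine integral_congr_ae (ae_of_all _ fun w => ?_)
    dsimp only
    rw [hL, mul_comm]
  have e_1 : ∫ q, collisionDensity q * T q ∂Λ = 0 := by
    have h := integral_collisionDensity_transfer_mul_eq_integral_mul_hardSphereLinearizedOp hψm hψ h1_mem
    simp only [mul_one, one_mul, hL] at h
    rw [hT, h, hg0]
  have e_diff : ∫ q, collisionDensity q * (T q * (s q.1.1 * s q.1.2)) ∂Λ -
      ∫ q, collisionDensity q * (T q * (ζ q.1.1 * ζ q.1.2)) ∂Λ = 2 * c * ∫ w, g w * s w ∂γ := by
    rw [← integral_sub i_ss i_ζζ]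
    have hpt : (fun q : CollSpace => collisionDensity q * (T q * (s q.1.1 * s q.1.2)) -
        collisionDensity q * (T q * (ζ q.1.1 * ζ q.1.2))) = fun q =>
        c * (collisionDensity q * (T q * s q.1.1)) + c * (collisionDensity q * (T q * s q.1.2)) -
          c ^ 2 * (collisionDensity q * T q) := by
      funext q; simp only [hζ]; ring
    rw [hpt, integral_sub (f := fun q : CollSpace => c * (collisionDensity q * (T q * s q.1.1)) +
        c * (collisionDensity q * (T q * s q.1.2))) ((i_s.const_mul c).add (i_s'.const_mul c))
        (i_1.const_mul _), integral_add (i_s.const_mul c) (i_s'.const_mul c), integral_const_mul,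
      integral_const_mul, integral_const_mul, e_s', e_s, e_1]
    ring
  have e_Ξ : ∫ q, collisionDensity q * (T q * hellingerDefect r q) ∂Λ =
      -2 * ∫ q, collisionDensity q * (T q * (s q.1.1 * s q.1.2)) ∂Λ := by
    have h : ∫ q, collisionDensity q * (T q * hellingerDefect r q) ∂Λ =
        ∫ q, collisionDensity q * (T q * (s (collide q.2 q.1).1 * s (collide q.2 q.1).2)) ∂Λ -
          ∫ q, collisionDensity q * (T q * (s q.1.1 * s q.1.2)) ∂Λ := by
      rw [← integral_sub i_pp i_ss]
      refine integral_congr_ae (ae_of_all _ fun q => ?_)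
      simp only [hellingerDefect, hs]
      ring
    rw [h, e_pp]
    ring
  -- the fibre identity
  have key : ∫ w, g w * r w ∂γ = ∫ w, g w * ζ w ^ 2 ∂γ -
      2⁻¹ * ∫ q, collisionDensity q * (T q * hellingerDefect r q) ∂Λ -
        ∫ q, collisionDensity q * (T q * (ζ q.1.1 * ζ q.1.2)) ∂Λ := by
    rw [hγid, e_Ξ, ← e_diff]
    ring
  -- the three bounds
  have hH : ∫⁻ w, ENNReal.ofReal ((Real.sqrt (r w) - c) ^ 2) ∂γ = ∫⁻ w, ‖ζ w‖ₑ ^ (2 : ℝ) ∂γ := by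
    refine lintegral_congr fun w => ?_
    rw [Real.enorm_eq_ofReal_abs, ENNReal.ofReal_rpow_of_nonneg (abs_nonneg _) two_pos.le, Real.rpow_two,
      sq_abs]
  have bΞ : ‖∫ q, collisionDensity q * (T q * hellingerDefect r q) ∂Λ‖ₑ ≤
      (∫⁻ q, ENNReal.ofReal (collisionDensity q * T q ^ 2) ∂Λ) ^ (1 / 2 : ℝ) *
        (∫⁻ q, ENNReal.ofReal (collisionDensity q * hellingerDefect r q ^ 2) ∂Λ) ^ (1 / 2 : ℝ) := by
    refine (enorm_integral_le_lintegral_enorm _).trans ?_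
    have hΞm : Measurable (hellingerDefect r : CollSpace → ℝ) := by
      have hc : Continuous fun q : CollSpace => collide q.2 q.1 := by fun_prop
      unfold hellingerDefect
      exact ((hsm.comp (hc.measurable.fst)).mul (hsm.comp hc.measurable.snd)).sub
        ((hsm.comp measurable_fst.fst).mul (hsm.comp measurable_fst.snd))
    exact lintegral_enorm_weight_mul_mul_le collisionDensity_nonneg measurable_collisionDensity
      (by simp only [hT]; exact measurable_transfer hψm) hΞm
  have bζζ : ‖∫ q, collisionDensity q * (T q * (ζ q.1.1 * ζ q.1.2)) ∂Λ‖ₑ ≤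
      ENNReal.ofReal K * ENNReal.ofReal A * ∫⁻ w, ENNReal.ofReal ((Real.sqrt (r w) - c) ^ 2) ∂γ := by
    refine (enorm_integral_le_lintegral_enorm _).trans ?_
    have h := hK (fun p => ζ p.1 * ζ p.2) (hζ_mem.1.comp_fst.mul hζ_mem.1.comp_snd)
    rw [eLpNorm_two_tensor hζ_mem.1 hζ_mem.1] at h
    refine h.trans (le_of_eq ?_)
    rw [hH]
    congr 1
    rw [← pow_two, ← ENNReal.rpow_two,
      eLpNorm_eq_lintegral_rpow_enorm_toReal two_ne_zero ENNReal.ofNat_ne_top, ENNReal.toReal_ofNat,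
      ← ENNReal.rpow_mul, show (1 / (2 : ℝ)) * 2 = 1 by norm_num, ENNReal.rpow_one]
  have bgζ : ‖∫ w, g w * ζ w ^ 2 ∂γ‖ₑ ≤
      ENNReal.ofReal b * ∫⁻ w, ENNReal.ofReal ((Real.sqrt (r w) - c) ^ 2) ∂γ := by
    refine (enorm_integral_le_lintegral_enorm _).trans ?_
    rw [← lintegral_const_mul' _ _ ENNReal.ofReal_ne_top]
    refine lintegral_mono fun w => ?_
    rw [enorm_mul, Real.enorm_eq_ofReal_abs, Real.enorm_eq_ofReal (sq_nonneg _)]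
    exact mul_le_mul_left (ENNReal.ofReal_le_ofReal (hgb w)) _
  have h2 : ‖(2⁻¹ : ℝ)‖ₑ = 2⁻¹ := by
    rw [Real.enorm_eq_ofReal (by norm_num), ENNReal.ofReal_inv_of_pos two_pos, ENNReal.ofReal_ofNat]
  -- assemble
  rw [key]
  calc ‖∫ w, g w * ζ w ^ 2 ∂γ - 2⁻¹ * ∫ q, collisionDensity q * (T q * hellingerDefect r q) ∂Λ -
        ∫ q, collisionDensity q * (T q * (ζ q.1.1 * ζ q.1.2)) ∂Λ‖ₑ
      ≤ ‖∫ w, g w * ζ w ^ 2 ∂γ‖ₑ + ‖(2⁻¹ : ℝ) * ∫ q, collisionDensity q * (T q * hellingerDefect r q) ∂Λ‖ₑ +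
          ‖∫ q, collisionDensity q * (T q * (ζ q.1.1 * ζ q.1.2)) ∂Λ‖ₑ :=
        enorm_sub_le.trans (add_le_add_left enorm_sub_le _)
    _ ≤ ENNReal.ofReal b * ∫⁻ w, ENNReal.ofReal ((Real.sqrt (r w) - c) ^ 2) ∂γ +
          2⁻¹ * ((∫⁻ q, ENNReal.ofReal (collisionDensity q * T q ^ 2) ∂Λ) ^ (1 / 2 : ℝ) *
            (∫⁻ q, ENNReal.ofReal (collisionDensity q * hellingerDefect r q ^ 2) ∂Λ) ^ (1 / 2 : ℝ)) +
          ENNReal.ofReal K * ENNReal.ofReal A * ∫⁻ w, ENNReal.ofReal ((Real.sqrt (r w) - c) ^ 2) ∂γ := by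
        rw [enorm_mul, h2]
        gcongr
    _ = _ := by
        rw [ENNReal.ofReal_add (mul_nonneg hK0 hA) hb, ENNReal.ofReal_mul hK0]
        ring

/-! ## The stub -/

/-- The crux's orthogonality clause is `M`-orthogonality to the collision invariants in the
Literature vocabulary (`mem_collisionInvariants_iff`). -/
theorem orthogonal_collisionInvariants {g : V3 → ℝ} (h : Orthogonal g) :
    ∀ φ ∈ collisionInvariants V3, maxwellianInner g φ = 0 := by
  intro φ hφ
  obtain ⟨a, c, b, rfl⟩ := mem_collisionInvariants_iff.1 hφ
  exact h a c b

/-- **Stub `stub_gainDomination`** (registered signature): GAIN–DISSIPATION DUALITY, nonlinear. -/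
theorem stub_gainDomination : GainDomination := by
  haveI hT3 : IsProbabilityMeasure (volume : Measure T3) := ⟨by rw [volume_pi, Measure.pi_univ]; simp⟩
  haveI := isFiniteMeasure_sphereMeasure (E := V3)
  haveI : IsProbabilityMeasure refMeasure := by
    change IsProbabilityMeasure ((volume : Measure T3).prod (stdGaussian V3)); infer_instance
  haveI : SFinite (sphereMeasure : Measure (Metric.sphere (0 : V3) 1)) := inferInstance
  haveI : SFinite collMeasure := by
    change SFinite (((volume : Measure V3).prod volume).prod sphereMeasure); infer_instance
  -- absolute constants
  obtain ⟨K, hK0, hK⟩ := exists_lintegral_collisionDensity_transfer_mul_le (E := V3)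
  obtain ⟨lam, CK, -, hCK, hinv⟩ := exists_continuous_inverse_hardSphereLinearizedOp_quartic
  set κ₁ : ℝ := 1 / (2 * (K * CK + 1)) with hκ₁
  have hκ₁0 : 0 < κ₁ := by positivity
  have hhalf : K * (CK * κ₁) + κ₁ ≤ 2⁻¹ := by
    rw [hκ₁]
    have hpos : 0 < K * CK + 1 := by positivity
    rw [show K * (CK * (1 / (2 * (K * CK + 1)))) + 1 / (2 * (K * CK + 1)) =
      (K * CK + 1) / (2 * (K * CK + 1)) by ring, div_mul_eq_div_div_swap, div_self hpos.ne', one_div]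
  refine ⟨κ₁, hκ₁0, fun g hg hgb horth => ?_⟩
  -- the Chapman–Enskog inverse of `g`
  obtain ⟨ψ, hψc, hψb, -, -, -, hL⟩ := hinv g κ₁ hg hgb (orthogonal_collisionInvariants horth)
  have hψm : Measurable ψ := hψc.measurable
  have hψ : ∀ u, |ψ u| ≤ CK * κ₁ * (1 + ‖u‖ ^ 2) ^ 2 := hψb
  have hg0 : ∫ w, g w ∂stdGaussian V3 = 0 := by simpa using horth 1 0 0
  set K₁ : ℝ≥0∞ := (∫⁻ q, ENNReal.ofReal (collisionDensity q *
    (ψ (collide q.2 q.1).1 + ψ (collide q.2 q.1).2 - ψ q.1.1 - ψ q.1.2) ^ 2) ∂collMeasure) ^ (1 / 2 : ℝ)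
    with hK₁
  have hK₁t : K₁ ≠ ∞ :=
    ENNReal.rpow_ne_top_of_nonneg (by norm_num) (lintegral_collisionDensity_transfer_sq_lt_top hψ).ne
  refine ⟨2⁻¹ * K₁.toReal, by positivity, fun φ hφm hφb f hfP hf hKL d hd hprod => ?_⟩
  -- densities and fibre quantities
  set γ : Measure V3 := stdGaussian V3 with hγ
  have href : refMeasure = (volume : Measure T3).prod γ := rfl
  set ρ : T3 × V3 → ℝ := fun y => (f.rnDeriv refMeasure y).toReal with hρ
  set n : T3 → ℝ := fun x => (f.fst.rnDeriv volume x).toReal with hn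
  have hρm : Measurable ρ := (Measure.measurable_rnDeriv _ _).ennreal_toReal
  have hρ0 : ∀ y, 0 ≤ ρ y := fun y => ENNReal.toReal_nonneg
  have hρi : Integrable ρ ((volume : Measure T3).prod γ) := href ▸ Measure.integrable_toReal_rnDeriv
  set G : T3 → ℝ := fun x => ∫ w, g w * ρ (x, w) ∂γ with hG
  set D : T3 → ℝ≥0∞ := fun x => ∫⁻ q, ENNReal.ofReal (collisionDensity q *
    hellingerDefect (fun w => ρ (x, w)) q ^ 2) ∂collMeasure with hD
  set H : T3 → ℝ≥0∞ := fun x => ∫⁻ w, ENNReal.ofReal ((Real.sqrt (ρ (x, w)) - Real.sqrt (n x)) ^ 2) ∂γ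
    with hH
  -- Step 1: disintegrate the gain
  have hgρi : Integrable (fun y : T3 × V3 => g y.2 * ρ y) ((volume : Measure T3).prod γ) :=
    hρi.bdd_mul (hg.measurable.comp measurable_snd).aestronglyMeasurable
      (ae_of_all _ fun y => by rw [Real.norm_eq_abs]; exact hgb y.2)
  have hφgρi : Integrable (fun y : T3 × V3 => φ y.1 * (g y.2 * ρ y)) ((volume : Measure T3).prod γ) :=
    hgρi.bdd_mul (hφm.comp measurable_fst).aestronglyMeasurable
      (ae_of_all _ fun y => by rw [Real.norm_eq_abs]; exact hφb y.1)
  have hGi : Integrable G (volume : Measure T3) := hgρi.integral_prod_left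
  have step1 : ∫ y, φ y.1 * g y.2 ∂f = ∫ x, φ x * G x := by
    calc ∫ y, φ y.1 * g y.2 ∂f = ∫ y, (f.rnDeriv refMeasure y).toReal * (φ y.1 * g y.2) ∂refMeasure :=
          (integral_toReal_rnDeriv_mul hf).symm
      _ = ∫ y, φ y.1 * (g y.2 * ρ y) ∂((volume : Measure T3).prod γ) := by
          refine integral_congr_ae (ae_of_all _ fun y => ?_)
          simp only [hρ]
          ring
      _ = ∫ x, ∫ w, φ x * (g w * ρ (x, w)) ∂γ := integral_prod _ hφgρi
      _ = ∫ x, φ x * G x := integral_congr_ae (ae_of_all _ fun x => integral_const_mul _ _)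
  -- Step 2: pass to the absolute value and to `ℝ≥0∞`
  have step2 : ∫ x, φ x * G x ≤ (∫⁻ x, ‖G x‖ₑ).toReal := by
    calc ∫ x, φ x * G x ≤ ∫ x, ‖G x‖ := by
          refine integral_mono (hGi.bdd_mul hφm.aestronglyMeasurable
            (ae_of_all _ fun x => by rw [Real.norm_eq_abs]; exact hφb x)) hGi.norm fun x => ?_
          calc φ x * G x ≤ |φ x * G x| := le_abs_self _
            _ = |φ x| * |G x| := abs_mul _ _
            _ ≤ 1 * ‖G x‖ := by rw [Real.norm_eq_abs]; gcongr; exact hφb x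
            _ = ‖G x‖ := one_mul _
      _ = (∫⁻ x, ‖G x‖ₑ).toReal := integral_norm_eq_lintegral_enorm hGi.aestronglyMeasurable
  -- Step 3: the fibre bound, for a.e. `x`
  have hfib : ∀ᵐ x ∂(volume : Measure T3),
      ‖G x‖ₑ ≤ 2⁻¹ * K₁ * D x ^ (1 / 2 : ℝ) + ENNReal.ofReal (K * (CK * κ₁) + κ₁) * H x := by
    filter_upwards [hρi.prod_right_ae] with x hx
    exact enorm_integral_mul_le_sqrt_production_add hg.measurable hgb hg0 hψm hψ hL hK0 (hK ψ _ hψ)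
      (hρm.comp measurable_prodMk_left) (fun w => hρ0 _) hx (Real.sqrt (n x))
  -- Step 4: integrate in `x`
  have hcoll : Continuous fun q : CollSpace => collide q.2 q.1 := by fun_prop
  have hDm : Measurable D := by
    have hF : Measurable fun p : T3 × CollSpace => ENNReal.ofReal (collisionDensity p.2 *
        hellingerDefect (fun w => ρ (p.1, w)) p.2 ^ 2) := by
      refine (measurable_collisionDensity.comp measurable_snd).mul ((Measurable.sub ?_ ?_).pow_const _)
        |>.ennreal_ofReal
      · exact ((hρm.comp (measurable_fst.prodMk ((hcoll.measurable.comp measurable_snd).fst))).sqrt).mul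
          ((hρm.comp (measurable_fst.prodMk ((hcoll.measurable.comp measurable_snd).snd))).sqrt)
      · exact ((hρm.comp (measurable_fst.prodMk (measurable_snd.fst.fst))).sqrt).mul
          ((hρm.comp (measurable_fst.prodMk (measurable_snd.fst.snd))).sqrt)
    exact hF.lintegral_prod_right'
  have hHm : Measurable H := by
    have hF : Measurable fun p : T3 × V3 => ENNReal.ofReal ((Real.sqrt (ρ (p.1, p.2)) - Real.sqrt (n p.1)) ^ 2) :=
      ((hρm.sqrt).sub ((Measure.measurable_rnDeriv _ _).ennreal_toReal.sqrt.comp measurable_fst)).pow_const _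
        |>.ennreal_ofReal
    exact hF.lintegral_prod_right'
  have hsqrt : ∫⁻ x, D x ^ (1 / 2 : ℝ) ≤ (ENNReal.ofReal d) ^ (1 / 2 : ℝ) := by
    have h := ENNReal.lintegral_mul_le_Lp_mul_Lq (volume : Measure T3) Real.HolderConjugate.two_two
      ((hDm.pow_const (1 / 2 : ℝ)).aemeasurable) (aemeasurable_const (b := (1 : ℝ≥0∞)))
    have hpow : ∀ x, (D x ^ (1 / 2 : ℝ)) ^ (2 : ℝ) = D x := fun x => by
      rw [← ENNReal.rpow_mul, show (1 / 2 : ℝ) * 2 = 1 by norm_num, ENNReal.rpow_one]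
    simp only [Pi.mul_apply, mul_one, hpow, ENNReal.one_rpow, lintegral_const, measure_univ] at h
    refine h.trans (ENNReal.rpow_le_rpow ?_ (by norm_num))
    exact hprod
  have hHle : ∫⁻ x, H x ≤ velKL f :=
    Literature.Probability.Divergences.lintegral_sqrt_rnDeriv_sub_sqrt_fst_sq_le_klDiv volume γ f hf
  have step4 : ∫⁻ x, ‖G x‖ₑ ≤ 2⁻¹ * K₁ * (ENNReal.ofReal d) ^ (1 / 2 : ℝ) + 2⁻¹ * velKL f := by
    calc ∫⁻ x, ‖G x‖ₑ ≤ ∫⁻ x, (2⁻¹ * K₁ * D x ^ (1 / 2 : ℝ) + ENNReal.ofReal (K * (CK * κ₁) + κ₁) * H x) :=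
          lintegral_mono_ae hfib
      _ = 2⁻¹ * K₁ * (∫⁻ x, D x ^ (1 / 2 : ℝ)) + ENNReal.ofReal (K * (CK * κ₁) + κ₁) * ∫⁻ x, H x := by
          rw [lintegral_add_left ((hDm.pow_const _).const_mul _), lintegral_const_mul _ (hDm.pow_const _),
            lintegral_const_mul _ hHm]
      _ ≤ 2⁻¹ * K₁ * (ENNReal.ofReal d) ^ (1 / 2 : ℝ) + ENNReal.ofReal 2⁻¹ * velKL f :=
          add_le_add (mul_le_mul_right hsqrt (2⁻¹ * K₁))
            (mul_le_mul' (ENNReal.ofReal_le_ofReal hhalf) hHle)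
      _ = _ := by rw [ENNReal.ofReal_inv_of_pos two_pos, ENNReal.ofReal_ofNat]
  -- Step 5: back to `ℝ`
  have h1t : 2⁻¹ * K₁ * (ENNReal.ofReal d) ^ (1 / 2 : ℝ) ≠ ∞ :=
    ENNReal.mul_ne_top (ENNReal.mul_ne_top (by simp) hK₁t)
      (ENNReal.rpow_ne_top_of_nonneg (by norm_num) ENNReal.ofReal_ne_top)
  have h2t : 2⁻¹ * velKL f ≠ ∞ := ENNReal.mul_ne_top (by simp) hKL
  calc ∫ y, φ y.1 * g y.2 ∂f = ∫ x, φ x * G x := step1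
    _ ≤ (∫⁻ x, ‖G x‖ₑ).toReal := step2
    _ ≤ (2⁻¹ * K₁ * (ENNReal.ofReal d) ^ (1 / 2 : ℝ) + 2⁻¹ * velKL f).toReal :=
        ENNReal.toReal_mono (ENNReal.add_ne_top.2 ⟨h1t, h2t⟩) step4
    _ = 2⁻¹ * K₁.toReal * Real.sqrt d + 2⁻¹ * (velKL f).toReal := by
        rw [ENNReal.toReal_add h1t h2t, ENNReal.toReal_mul, ENNReal.toReal_mul, ENNReal.toReal_mul,
          ENNReal.toReal_inv, ENNReal.toReal_ofNat, ENNReal.ofReal_rpow_of_nonneg hd (by norm_num),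
          ENNReal.toReal_ofReal (Real.rpow_nonneg hd _), Real.sqrt_eq_rpow]

end Summit.AtomisticToContinuum.HydrodynamicLimit.Theorems.HTheorem

end
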